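import Summits.QuantumFields.YangMills.Theorems.SwapVirialDeficitZeroModeExactCommutatorBall
import Summits.QuantumFields.YangMills.Theorems.ToronValleyVolumeZeroModeLog4Rung
import HarnessLib

/-!
# Zero-mode EXACT rung Z3: the nearly commuting PAIR — `Haar²{‖[q₁,q₂]‖ ≤ t} = t²/2 − O(t³)`, EXACT leading constant `v₂ = 1/2`
# (free-hands support of crux ⟨stmt-QuantumFields-24197⟩ `SwapVirialDeficit.SwapGluedStiffness`; item Z3 of fcl-p3 g43's zero-mode exact rung plan
# `memo-24197-zero-mode-exact-rung.md`, evidence #10 on ⟨24197⟩)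

By Fubini and the exact one-letter ball ✓`haar_commBall_eq_ofReal` (file Z1-b) the pair event has the EXACT Haar mass
`Haar²{(u₁,u₂) | ‖q u₁·q u₂ − q u₂·q u₁‖ ≤ t} = ∫ min(1, t²/(4‖Im q a‖²)) dHaar(a)`, and in the gnomonic chart `‖Im q a‖² = |v|²/(1+|v|²)`, so
* `∫ t²/(4‖Im q a‖²) dHaar(a) = (t²/4)·π⁻²∫_{ℝ³}|v|⁻²(1+|v|²)⁻¹dv = (t²/4)·(4/π)·(π/2) = t²/2` (§8–§9: `E[‖Im q‖⁻²] = 2` EXACTLY), and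
* the saturation region `‖Im q a‖ < t/2` (`|v| < ρ`, `ρ² = t²/(4−t²)`) costs at most `(t²/4)·π⁻²·4πρ = t²ρ/π`.
★★★ `haar_pair_commBall_two_sided`: `t²/2 − t²ρ/π ≤ Haar²{‖[q₁,q₂]‖ ≤ t} ≤ t²/2` (`0 ≤ t < 2`), ★★★ `abs_haar_pair_commBall_sub_le`: `|Haar²{…} − t²/2| ≤ t³`
(`0 ≤ t ≤ 1`) — exponent `2`, EXACT constant `v₂ = 1/2`, remainder exponent `θ = 1`, as predicted in the plan (`v₂ = ¼·E[(1−re²)⁻¹]`, `E[(1−re²)⁻¹] = 2`).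

HONEST LABEL: an exact finite-dimensional Haar-measure asymptotic (plan-level zero-mode rung Z3 of a DRAFT line); NOT the fixed-`L` sharp law, NOT ⟨24197⟩;
no rung / summit statement is proved; the Yang–Mills mass gap is NOT proved; no summit is proved by a line.  Width seat ym-line-sfw-p2-w3 g62 (cell
ym-idea-1, free hands; own crux ⟨22884⟩ blocked-on ⟨19935⟩), `--supports stmt-QuantumFields-24197`.  THEOREMS ONLY, standard axioms, 0 `sorry`.
References: [cite: Chatterjee2026YMHiggs, Lemma 5.1 / Cor. 5.2]; [folklore].
-/

set_option autoImplicit false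

noncomputable section

open MeasureTheory Quaternion Set Real
open scoped Quaternion ENNReal BigOperators
open Literature.MathematicalPhysics.QuantumLattice
open Literature.MathematicalPhysics.QuantumFieldTheory (haarProbability)
open Literature.MathematicalPhysics.QuantumFieldTheory.Balaban1983to89.T4HaarSU2Translate (su2Quat_quatToSU2 measurable_su2Quat
  continuous_su2Quat)
open Summit.QuantumFields.YangMills.Theorems.SwapTwistDeficit.ToronLog
open Summit.QuantumFields.YangMills.Theorems.SwapVirialDeficit.ZeroModeGroup (volume_imJ_eq_zero)
open Summit.QuantumFields.YangMills.Theorems.ToronValleyVolume.NearlyCommutingCeiling (sq_norm_im_eq)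
open Summit.QuantumFields.YangMills.Theorems.ToronValleyVolume.ZeroMode (lintegral_radial)

attribute [local instance] Literature.Analysis.FluidPDE.Tao2016.quatMeasurableSpace
  Literature.Analysis.FluidPDE.Tao2016.quatBorelSpace
  Literature.MathematicalPhysics.QuantumLattice.secondCountableTopology_su2

namespace Summit.QuantumFields.YangMills.Theorems.SwapVirialDeficit.ZeroModeExact

/-! ## §8 Radial integrals in the gnomonic chart -/

/-- Polar coordinates for the chart `ℝ³`: `∫_{ℝ³} f(Σᵢvᵢ²) dv = 4π·∫_{r>0} r²·f(r²) dr`. [folklore] -/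
theorem lintegral_chart_radial (f : ℝ → ℝ≥0∞) (hf : Measurable f) :
    ∫⁻ v : Fin 3 → ℝ, f (∑ i, v i ^ 2) = ENNReal.ofReal (4 * Real.pi) * ∫⁻ r in Ioi (0 : ℝ), ENNReal.ofReal (r ^ 2) * f (r ^ 2) := by
  have h1 := PiLp.volume_preserving_toLp (Fin 3)
  have hg : Measurable fun a : EuclideanSpace ℝ (Fin 3) => f (‖a‖ ^ 2) := hf.comp (continuous_norm.pow 2).measurable
  have heq : ∀ v : Fin 3 → ℝ, f (∑ i, v i ^ 2) = (fun a : EuclideanSpace ℝ (Fin 3) => f (‖a‖ ^ 2)) (WithLp.toLp 2 v) := by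
    intro v
    simp only [EuclideanSpace.real_norm_sq_eq]
  simp_rw [heq]
  rw [h1.lintegral_comp hg,
    show (fun a : EuclideanSpace ℝ (Fin 3) => f (‖a‖ ^ 2)) = fun a => (fun r : ℝ => f (r ^ 2)) ‖a‖ from rfl,
    lintegral_radial _ (show Measurable (fun r : ℝ => f (r ^ 2)) from hf.comp (measurable_id.pow_const 2)),
    EuclideanSpace.volume_ball_fin_three, ENNReal.ofReal_one, one_pow, one_mul,
    show (3 : ℝ≥0∞) = ENNReal.ofReal 3 by simp, ← ENNReal.ofReal_mul (by norm_num)]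
  congr 2; ring

/-- `π⁻²·∫_{ℝ³} |v|⁻²(1+|v|²)⁻¹ dv = 2`, i.e. `∫_{ℝ³} |v|⁻²(1+|v|²)⁻¹ dv = 2π²` — the exact value `E_Haar[‖Im q‖⁻²] = 2`. [folklore] -/
theorem lintegral_chart_invSq :
    ∫⁻ v : Fin 3 → ℝ, ENNReal.ofReal ((∑ i, v i ^ 2)⁻¹ * (1 + ∑ i, v i ^ 2)⁻¹) = ENNReal.ofReal (2 * Real.pi ^ 2) := by
  have hm : Measurable fun s : ℝ => ENNReal.ofReal (s⁻¹ * (1 + s)⁻¹) := ENNReal.measurable_ofReal.comp (by fun_prop)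
  rw [show (fun v : Fin 3 → ℝ => ENNReal.ofReal ((∑ i, v i ^ 2)⁻¹ * (1 + ∑ i, v i ^ 2)⁻¹)) =
      fun v => (fun s : ℝ => ENNReal.ofReal (s⁻¹ * (1 + s)⁻¹)) (∑ i, v i ^ 2) from rfl, lintegral_chart_radial _ hm]
  have hpt : ∀ r ∈ Ioi (0 : ℝ), ENNReal.ofReal (r ^ 2) * ENNReal.ofReal ((r ^ 2)⁻¹ * (1 + r ^ 2)⁻¹) = ENNReal.ofReal ((1 + r ^ 2)⁻¹) := by
    intro r hr
    have hr' : (0 : ℝ) < r := hr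
    rw [← ENNReal.ofReal_mul (sq_nonneg _)]
    congr 1
    field_simp
  rw [setLIntegral_congr_fun measurableSet_Ioi hpt, ← ofReal_integral_eq_lintegral_ofReal integrable_inv_one_add_sq.integrableOn
    (Filter.Eventually.of_forall fun r => by positivity), integral_Ioi_inv_one_add_sq, Real.arctan_zero, sub_zero,
    ← ENNReal.ofReal_mul (by positivity)]
  congr 1; ring

/-- The saturation region: `∫_{|v|² < ρ²} |v|⁻²(1+|v|²)⁻¹ dv ≤ 4πρ` (`ρ ≥ 0`). [folklore] -/
theorem lintegral_chart_invSq_ball_le {ρ : ℝ} (hρ : 0 ≤ ρ) :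
    ∫⁻ v : Fin 3 → ℝ, (Set.Iio (ρ ^ 2)).indicator (fun s : ℝ => ENNReal.ofReal (s⁻¹ * (1 + s)⁻¹)) (∑ i, v i ^ 2) ≤
      ENNReal.ofReal (4 * Real.pi * ρ) := by
  have hm : Measurable ((Set.Iio (ρ ^ 2)).indicator (fun s : ℝ => ENNReal.ofReal (s⁻¹ * (1 + s)⁻¹))) :=
    (ENNReal.measurable_ofReal.comp (by fun_prop)).indicator measurableSet_Iio
  rw [lintegral_chart_radial _ hm]
  have hpt : ∀ r ∈ Ioi (0 : ℝ), ENNReal.ofReal (r ^ 2) * (Set.Iio (ρ ^ 2)).indicator (fun s : ℝ => ENNReal.ofReal (s⁻¹ * (1 + s)⁻¹)) (r ^ 2)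
      ≤ (Set.Ioo 0 ρ).indicator (fun _ => (1 : ℝ≥0∞)) r := by
    intro r hr
    have hr' : (0 : ℝ) < r := hr
    by_cases h : r ^ 2 ∈ Set.Iio (ρ ^ 2)
    · have hrρ : r < ρ := by
        have : r ^ 2 < ρ ^ 2 := h
        nlinarith
      rw [indicator_of_mem h, indicator_of_mem (show r ∈ Ioo 0 ρ from ⟨hr', hrρ⟩), ← ENNReal.ofReal_mul (sq_nonneg _),
        ← ENNReal.ofReal_one]
      refine ENNReal.ofReal_le_ofReal ?_
      rw [show r ^ 2 * ((r ^ 2)⁻¹ * (1 + r ^ 2)⁻¹) = (1 + r ^ 2)⁻¹ by field_simp]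
      exact inv_le_one_of_one_le₀ (by nlinarith)
    · rw [indicator_of_notMem h, mul_zero]; exact zero_le
  calc ENNReal.ofReal (4 * Real.pi) * ∫⁻ r in Ioi (0 : ℝ), ENNReal.ofReal (r ^ 2) *
        (Set.Iio (ρ ^ 2)).indicator (fun s : ℝ => ENNReal.ofReal (s⁻¹ * (1 + s)⁻¹)) (r ^ 2)
      ≤ ENNReal.ofReal (4 * Real.pi) * ∫⁻ r in Ioi (0 : ℝ), (Set.Ioo 0 ρ).indicator (fun _ => (1 : ℝ≥0∞)) r :=
        mul_le_mul_right (setLIntegral_mono' measurableSet_Ioi hpt) _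
    _ ≤ ENNReal.ofReal (4 * Real.pi) * ENNReal.ofReal ρ := by
        gcongr
        calc ∫⁻ r in Ioi (0 : ℝ), (Set.Ioo 0 ρ).indicator (fun _ => (1 : ℝ≥0∞)) r
            ≤ ∫⁻ r, (Set.Ioo 0 ρ).indicator (fun _ => (1 : ℝ≥0∞)) r := setLIntegral_le_lintegral _ _
          _ = ENNReal.ofReal ρ := by
              rw [lintegral_indicator measurableSet_Ioo, setLIntegral_const, one_mul, Real.volume_Ioo, sub_zero]
    _ = ENNReal.ofReal (4 * Real.pi * ρ) := by rw [← ENNReal.ofReal_mul (by positivity)]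

/-! ## §9 The one-letter profile `min(1, t²/(4‖Im q a‖²))` and its Haar integral -/

/-- `‖Im q(P(±(1,v)))‖² = |v|²/(1+|v|²)` in the gnomonic chart. [folklore] -/
theorem sq_norm_im_proj_gnomonic (v : Fin 3 → ℝ) (s : Bool) :
    ‖(su2Quat (quatToSU2 (if s then gnomonicQuat v else -gnomonicQuat v))).im‖ ^ 2 = (∑ i, v i ^ 2) / (1 + ∑ i, v i ^ 2) := by
  have hx : (if s then gnomonicQuat v else -gnomonicQuat v) ≠ 0 := by
    cases s
    · simpa using neg_ne_zero.2 (gnomonicQuat_ne_zero v)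
    · simpa using gnomonicQuat_ne_zero v
  have hn : ‖(if s then gnomonicQuat v else -gnomonicQuat v)‖ ^ 2 = 1 + ∑ i, v i ^ 2 := by
    cases s
    · simp only [Bool.false_eq_true, ↓reduceIte, norm_neg]; exact sq_norm_gnomonicQuat v
    · simp only [↓reduceIte]; exact sq_norm_gnomonicQuat v
  have him : ‖(if s then gnomonicQuat v else -gnomonicQuat v).im‖ ^ 2 = ∑ i, v i ^ 2 := by
    rw [WeakCouplingRates.sq_norm_im, Fin.sum_univ_three]
    cases s <;> simp [gnomonicQuat]
  have hpos : 0 < 1 + ∑ i, v i ^ 2 := by positivity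
  rw [su2Quat_quatToSU2 hx, Quaternion.im_smul, norm_smul, norm_inv, norm_norm, mul_pow, inv_pow, hn, him, inv_mul_eq_div]

/-- The profile in the chart: `(t²/(4‖Im q‖²))·(1+|v|²)⁻² = (t²/4)·|v|⁻²(1+|v|²)⁻¹` (both sides `0` at `v = 0` by the `x/0 = 0` convention).
[folklore] -/
theorem profile_chart (t : ℝ) (v : Fin 3 → ℝ) (s : Bool) :
    t ^ 2 / (4 * ‖(su2Quat (quatToSU2 (if s then gnomonicQuat v else -gnomonicQuat v))).im‖ ^ 2) * ((1 + ∑ i, v i ^ 2)⁻¹) ^ 2 =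
      t ^ 2 / 4 * ((∑ i, v i ^ 2)⁻¹ * (1 + ∑ i, v i ^ 2)⁻¹) := by
  rw [sq_norm_im_proj_gnomonic]
  have hpos : 0 < 1 + ∑ i, v i ^ 2 := by positivity
  by_cases h0 : ∑ i, v i ^ 2 = 0
  · rw [h0]; simp
  · field_simp

/-- ★ **`E_Haar[t²/(4‖Im q‖²)] = t²/2`** (lower-integral form). [folklore] -/
theorem lintegral_haar_profile (t : ℝ) :
    ∫⁻ a, ENNReal.ofReal (t ^ 2 / (4 * ‖(su2Quat a).im‖ ^ 2)) ∂(haarProbability (Matrix.specialUnitaryGroup (Fin 2) ℂ)) =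
      ENNReal.ofReal (t ^ 2 / 2) := by
  have hF : Measurable fun a : Matrix.specialUnitaryGroup (Fin 2) ℂ => ENNReal.ofReal (t ^ 2 / (4 * ‖(su2Quat a).im‖ ^ 2)) :=
    ENNReal.measurable_ofReal.comp ((measurable_const.div ((((Quaternion.continuous_im.comp continuous_su2Quat).norm).pow 2
      |>.measurable).const_mul 4)))
  rw [lintegral_haarProbability_su2_gnomonic _ hF]
  have hpt : ∀ v : Fin 3 → ℝ, (ENNReal.ofReal (t ^ 2 / (4 * ‖(su2Quat (quatToSU2 (gnomonicQuat v))).im‖ ^ 2)) +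
      ENNReal.ofReal (t ^ 2 / (4 * ‖(su2Quat (quatToSU2 (-gnomonicQuat v))).im‖ ^ 2))) * ENNReal.ofReal (((1 + ∑ i, v i ^ 2)⁻¹) ^ 2)
      = ENNReal.ofReal (t ^ 2 / 2) * ENNReal.ofReal ((∑ i, v i ^ 2)⁻¹ * (1 + ∑ i, v i ^ 2)⁻¹) := by
    intro v
    have hp := profile_chart t v true
    have hm := profile_chart t v false
    simp only [↓reduceIte, Bool.false_eq_true] at hp hm
    rw [add_mul, ← ENNReal.ofReal_mul (by positivity), ← ENNReal.ofReal_mul (by positivity), hp, hm,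
      ← ENNReal.ofReal_add (by positivity) (by positivity), ← ENNReal.ofReal_mul (by positivity)]
    congr 1; ring
  have hm2 : Measurable fun v : Fin 3 → ℝ => ENNReal.ofReal ((∑ i, v i ^ 2)⁻¹ * (1 + ∑ i, v i ^ 2)⁻¹) :=
    ENNReal.measurable_ofReal.comp (by fun_prop)
  simp_rw [hpt]
  rw [lintegral_const_mul _ hm2, lintegral_chart_invSq, ← ENNReal.ofReal_mul (by positivity), ← ENNReal.ofReal_mul (by positivity)]
  congr 1; field_simp

/-- ★ **The saturation defect**: `∫ 𝟙{‖Im q a‖² < t²/4}·t²/(4‖Im q a‖²) dHaar(a) ≤ t²ρ/π`, `ρ = t/√(4−t²)` (`0 ≤ t < 2`). [folklore] -/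
theorem lintegral_haar_profile_sat_le {t : ℝ} (ht : 0 ≤ t) (ht2 : t < 2) :
    ∫⁻ a, ({a : Matrix.specialUnitaryGroup (Fin 2) ℂ | ‖(su2Quat a).im‖ ^ 2 < t ^ 2 / 4}).indicator
        (fun a => ENNReal.ofReal (t ^ 2 / (4 * ‖(su2Quat a).im‖ ^ 2))) a ∂(haarProbability (Matrix.specialUnitaryGroup (Fin 2) ℂ)) ≤
      ENNReal.ofReal (t ^ 2 * (t / Real.sqrt (4 - t ^ 2)) / Real.pi) := by
  set ρ : ℝ := t / Real.sqrt (4 - t ^ 2) with hρdef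
  have h4 : 0 < 4 - t ^ 2 := by nlinarith
  have hρ : 0 ≤ ρ := div_nonneg ht (Real.sqrt_nonneg _)
  have hρ2 : ρ ^ 2 = t ^ 2 / (4 - t ^ 2) := by rw [hρdef, div_pow, Real.sq_sqrt h4.le]
  have hcont : Continuous fun a : Matrix.specialUnitaryGroup (Fin 2) ℂ => ‖(su2Quat a).im‖ ^ 2 :=
    ((Quaternion.continuous_im.comp continuous_su2Quat).norm).pow 2
  have hS : MeasurableSet {a : Matrix.specialUnitaryGroup (Fin 2) ℂ | ‖(su2Quat a).im‖ ^ 2 < t ^ 2 / 4} :=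
    measurableSet_lt hcont.measurable measurable_const
  have hF : Measurable (({a : Matrix.specialUnitaryGroup (Fin 2) ℂ | ‖(su2Quat a).im‖ ^ 2 < t ^ 2 / 4}).indicator
      (fun a => ENNReal.ofReal (t ^ 2 / (4 * ‖(su2Quat a).im‖ ^ 2)))) :=
    (ENNReal.measurable_ofReal.comp ((measurable_const.div ((hcont.measurable).const_mul 4)))).indicator hS
  rw [lintegral_haarProbability_su2_gnomonic _ hF]
  -- pointwise: the two chart points give the same value, dominated by the ball indicator
  have hpt : ∀ v : Fin 3 → ℝ, (({a : Matrix.specialUnitaryGroup (Fin 2) ℂ | ‖(su2Quat a).im‖ ^ 2 < t ^ 2 / 4}).indicator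
      (fun a => ENNReal.ofReal (t ^ 2 / (4 * ‖(su2Quat a).im‖ ^ 2))) (quatToSU2 (gnomonicQuat v)) +
      ({a : Matrix.specialUnitaryGroup (Fin 2) ℂ | ‖(su2Quat a).im‖ ^ 2 < t ^ 2 / 4}).indicator
      (fun a => ENNReal.ofReal (t ^ 2 / (4 * ‖(su2Quat a).im‖ ^ 2))) (quatToSU2 (-gnomonicQuat v))) *
      ENNReal.ofReal (((1 + ∑ i, v i ^ 2)⁻¹) ^ 2) ≤
      ENNReal.ofReal (t ^ 2 / 2) * (Set.Iio (ρ ^ 2)).indicator (fun s : ℝ => ENNReal.ofReal (s⁻¹ * (1 + s)⁻¹)) (∑ i, v i ^ 2) := by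
    intro v
    have hpos : 0 < 1 + ∑ i, v i ^ 2 := by positivity
    -- membership of either chart point forces `|v|² < ρ²`
    have hmem : ∀ s : Bool, quatToSU2 (if s then gnomonicQuat v else -gnomonicQuat v) ∈
        {a : Matrix.specialUnitaryGroup (Fin 2) ℂ | ‖(su2Quat a).im‖ ^ 2 < t ^ 2 / 4} → ∑ i, v i ^ 2 ∈ Set.Iio (ρ ^ 2) := by
      intro s hs
      rw [Set.mem_setOf_eq, sq_norm_im_proj_gnomonic, div_lt_iff₀ hpos] at hs
      rw [Set.mem_Iio, hρ2, lt_div_iff₀ h4]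
      nlinarith
    by_cases hv : ∑ i, v i ^ 2 ∈ Set.Iio (ρ ^ 2)
    · rw [indicator_of_mem hv]
      have hp := profile_chart t v true
      have hm := profile_chart t v false
      simp only [↓reduceIte, Bool.false_eq_true] at hp hm
      calc _ ≤ (ENNReal.ofReal (t ^ 2 / (4 * ‖(su2Quat (quatToSU2 (gnomonicQuat v))).im‖ ^ 2)) +
            ENNReal.ofReal (t ^ 2 / (4 * ‖(su2Quat (quatToSU2 (-gnomonicQuat v))).im‖ ^ 2))) *
            ENNReal.ofReal (((1 + ∑ i, v i ^ 2)⁻¹) ^ 2) := by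
            gcongr <;> exact Set.indicator_le_self _ _ _
        _ = ENNReal.ofReal (t ^ 2 / 2) * ENNReal.ofReal ((∑ i, v i ^ 2)⁻¹ * (1 + ∑ i, v i ^ 2)⁻¹) := by
            rw [add_mul, ← ENNReal.ofReal_mul (by positivity), ← ENNReal.ofReal_mul (by positivity), hp, hm,
              ← ENNReal.ofReal_add (by positivity) (by positivity), ← ENNReal.ofReal_mul (by positivity)]
            congr 1; ring
    · have h1 : quatToSU2 (gnomonicQuat v) ∉ {a : Matrix.specialUnitaryGroup (Fin 2) ℂ | ‖(su2Quat a).im‖ ^ 2 < t ^ 2 / 4} :=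
        fun h => hv (by simpa using hmem true (by simpa using h))
      have h2 : quatToSU2 (-gnomonicQuat v) ∉ {a : Matrix.specialUnitaryGroup (Fin 2) ℂ | ‖(su2Quat a).im‖ ^ 2 < t ^ 2 / 4} :=
        fun h => hv (by simpa using hmem false (by simpa using h))
      rw [indicator_of_notMem h1, indicator_of_notMem h2, indicator_of_notMem hv, zero_add, zero_mul, mul_zero]
  have hmI : Measurable fun v : Fin 3 → ℝ => (Set.Iio (ρ ^ 2)).indicator (fun s : ℝ => ENNReal.ofReal (s⁻¹ * (1 + s)⁻¹)) (∑ i, v i ^ 2) :=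
    ((ENNReal.measurable_ofReal.comp (by fun_prop : Measurable fun s : ℝ => s⁻¹ * (1 + s)⁻¹)).indicator measurableSet_Iio).comp
      (by fun_prop)
  calc _ ≤ ENNReal.ofReal (1 / (2 * Real.pi ^ 2)) * ∫⁻ v : Fin 3 → ℝ, ENNReal.ofReal (t ^ 2 / 2) *
        (Set.Iio (ρ ^ 2)).indicator (fun s : ℝ => ENNReal.ofReal (s⁻¹ * (1 + s)⁻¹)) (∑ i, v i ^ 2) :=
        mul_le_mul_right (lintegral_mono hpt) _
    _ ≤ ENNReal.ofReal (1 / (2 * Real.pi ^ 2)) * (ENNReal.ofReal (t ^ 2 / 2) * ENNReal.ofReal (4 * Real.pi * ρ)) := by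
        rw [lintegral_const_mul _ hmI]
        exact mul_le_mul_right (mul_le_mul_right (lintegral_chart_invSq_ball_le hρ) _) _
    _ = ENNReal.ofReal (t ^ 2 * ρ / Real.pi) := by
        rw [← ENNReal.ofReal_mul (by positivity), ← ENNReal.ofReal_mul (by positivity)]
        congr 1; field_simp; ring

/-! ## §10 Fubini over the first letter; central letters are null -/

/-- Central elements are Haar-null: `Haar{a | Im q a = 0} = 0`. [folklore] -/
theorem haar_im_eq_zero_null :
    haarProbability (Matrix.specialUnitaryGroup (Fin 2) ℂ) {a : Matrix.specialUnitaryGroup (Fin 2) ℂ | (su2Quat a).im = 0} = 0 := by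
  have hS : MeasurableSet {a : Matrix.specialUnitaryGroup (Fin 2) ℂ | (su2Quat a).im = 0} :=
    (isClosed_eq (Quaternion.continuous_im.comp continuous_su2Quat) continuous_const).measurableSet
  rw [haar_eq_cone_preimage hS]
  have hsub : quatToSU2 ⁻¹' {a : Matrix.specialUnitaryGroup (Fin 2) ℂ | (su2Quat a).im = 0} ⊆ {x : ℍ | x.imJ = 0} := by
    intro x hx
    rw [Set.mem_preimage, Set.mem_setOf_eq] at hx
    rw [Set.mem_setOf_eq]
    by_cases h0 : x = 0
    · rw [h0]; rfl
    · rw [su2Quat_quatToSU2 h0, Quaternion.im_smul, smul_eq_zero] at hx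
      rcases hx with h | h
      · exact absurd (inv_eq_zero.1 h) (norm_ne_zero_iff.2 h0)
      · have := congrArg (fun q : ℍ => q.imJ) h; simpa using this
  refine le_antisymm ?_ bot_le
  calc coneMeasure (quatToSU2 ⁻¹' {a : Matrix.specialUnitaryGroup (Fin 2) ℂ | (su2Quat a).im = 0})
      ≤ coneMeasure {x : ℍ | x.imJ = 0} := measure_mono hsub
    _ = 0 := by
        rw [coneMeasure, Measure.smul_apply, smul_eq_mul]
        have h : (volume : Measure ℍ).restrict (Metric.ball 0 1) {x : ℍ | x.imJ = 0} = 0 :=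
          le_antisymm ((Measure.restrict_apply_le _ _).trans (le_of_eq volume_imJ_eq_zero)) bot_le
        rw [h, mul_zero]

/-- The pair event is measurable. [folklore] -/
theorem measurableSet_pairBall (t : ℝ) :
    MeasurableSet {p : Matrix.specialUnitaryGroup (Fin 2) ℂ × Matrix.specialUnitaryGroup (Fin 2) ℂ |
      ‖su2Quat p.1 * su2Quat p.2 - su2Quat p.2 * su2Quat p.1‖ ≤ t} := by
  have h1 : Continuous fun p : Matrix.specialUnitaryGroup (Fin 2) ℂ × Matrix.specialUnitaryGroup (Fin 2) ℂ => su2Quat p.1 :=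
    continuous_su2Quat.comp continuous_fst
  have h2 : Continuous fun p : Matrix.specialUnitaryGroup (Fin 2) ℂ × Matrix.specialUnitaryGroup (Fin 2) ℂ => su2Quat p.2 :=
    continuous_su2Quat.comp continuous_snd
  exact measurableSet_le ((h1.mul h2).sub (h2.mul h1)).norm.measurable measurable_const

/-- ★★ **FUBINI + Z1**: `Haar²{‖[q₁,q₂]‖ ≤ t} = ∫ min(1, t²/(4‖Im q a‖²)) dHaar(a)` (`t ≥ 0`). [folklore] -/
theorem haar_pair_commBall_eq_lintegral {t : ℝ} (ht : 0 ≤ t) :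
    ((haarProbability (Matrix.specialUnitaryGroup (Fin 2) ℂ)).prod (haarProbability (Matrix.specialUnitaryGroup (Fin 2) ℂ)))
        {p | ‖su2Quat p.1 * su2Quat p.2 - su2Quat p.2 * su2Quat p.1‖ ≤ t} =
      ∫⁻ a, ENNReal.ofReal (min 1 (t ^ 2 / (4 * ‖(su2Quat a).im‖ ^ 2))) ∂(haarProbability (Matrix.specialUnitaryGroup (Fin 2) ℂ)) := by
  rw [Measure.prod_apply (measurableSet_pairBall t)]
  refine lintegral_congr_ae ?_
  have hae : ∀ᵐ a ∂(haarProbability (Matrix.specialUnitaryGroup (Fin 2) ℂ)), (su2Quat a).im ≠ 0 := ae_iff.2 (by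
    simpa using haar_im_eq_zero_null)
  filter_upwards [hae] with a ha
  have hs2 : ‖(su2Quat a).im‖ ^ 2 = 1 - (su2Quat a).re ^ 2 := by rw [sq_norm_im_eq, norm_su2Quat, one_pow]
  have hre : (su2Quat a).re ^ 2 < 1 := by
    have : 0 < ‖(su2Quat a).im‖ ^ 2 := by positivity
    linarith
  rw [show Prod.mk a ⁻¹' {p : Matrix.specialUnitaryGroup (Fin 2) ℂ × Matrix.specialUnitaryGroup (Fin 2) ℂ |
      ‖su2Quat p.1 * su2Quat p.2 - su2Quat p.2 * su2Quat p.1‖ ≤ t} =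
      {u | ‖su2Quat a * su2Quat u - su2Quat u * su2Quat a‖ ≤ t} from rfl, haar_commBall_eq_ofReal a hre ht, hs2]

/-! ## §11 ★★★ The exact pair law -/

/-- ★★★ **NEARLY COMMUTING PAIR, TWO-SIDED WITH THE EXACT CONSTANT**: for `0 ≤ t < 2`, with `ρ = t/√(4−t²)`,
`t²/2 − t²ρ/π ≤ Haar²{(u₁,u₂) | ‖q u₁·q u₂ − q u₂·q u₁‖ ≤ t} ≤ t²/2`. [folklore] -/
theorem haar_pair_commBall_two_sided {t : ℝ} (ht : 0 ≤ t) (ht2 : t < 2) :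
    t ^ 2 / 2 - t ^ 2 * (t / Real.sqrt (4 - t ^ 2)) / Real.pi ≤
      ((haarProbability (Matrix.specialUnitaryGroup (Fin 2) ℂ)).prod (haarProbability (Matrix.specialUnitaryGroup (Fin 2) ℂ))).real
        {p | ‖su2Quat p.1 * su2Quat p.2 - su2Quat p.2 * su2Quat p.1‖ ≤ t} ∧
    ((haarProbability (Matrix.specialUnitaryGroup (Fin 2) ℂ)).prod (haarProbability (Matrix.specialUnitaryGroup (Fin 2) ℂ))).real
        {p | ‖su2Quat p.1 * su2Quat p.2 - su2Quat p.2 * su2Quat p.1‖ ≤ t} ≤ t ^ 2 / 2 := by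
  set μ := haarProbability (Matrix.specialUnitaryGroup (Fin 2) ℂ) with hμ
  have hρ0 : 0 ≤ t / Real.sqrt (4 - t ^ 2) := div_nonneg ht (Real.sqrt_nonneg _)
  -- the three integrands: profile `X`, its saturation part, and `min(1,X)`
  set X : Matrix.specialUnitaryGroup (Fin 2) ℂ → ℝ := fun a => t ^ 2 / (4 * ‖(su2Quat a).im‖ ^ 2) with hX
  have hX0 : ∀ a, 0 ≤ X a := fun a => by rw [hX]; positivity
  have hmin_le : ∀ a, ENNReal.ofReal (min 1 (X a)) ≤ ENNReal.ofReal (X a) := fun a => ENNReal.ofReal_le_ofReal (min_le_right _ _)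
  have hX_le : ∀ a, ENNReal.ofReal (X a) ≤ ENNReal.ofReal (min 1 (X a)) +
      ({a : Matrix.specialUnitaryGroup (Fin 2) ℂ | ‖(su2Quat a).im‖ ^ 2 < t ^ 2 / 4}).indicator (fun a => ENNReal.ofReal (X a)) a := by
    intro a
    by_cases h : a ∈ {a : Matrix.specialUnitaryGroup (Fin 2) ℂ | ‖(su2Quat a).im‖ ^ 2 < t ^ 2 / 4}
    · rw [indicator_of_mem h]; exact le_add_self
    · rw [indicator_of_notMem h, add_zero]
      refine ENNReal.ofReal_le_ofReal (le_min ?_ le_rfl)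
      -- off the saturation region `X ≤ 1`
      rw [Set.mem_setOf_eq, not_lt] at h
      rw [hX]
      by_cases hz : ‖(su2Quat a).im‖ ^ 2 = 0
      · simp [hz]
      · rw [div_le_one (by positivity)]; linarith
  have hE := haar_pair_commBall_eq_lintegral ht
  have hup : μ.prod μ {p | ‖su2Quat p.1 * su2Quat p.2 - su2Quat p.2 * su2Quat p.1‖ ≤ t} ≤ ENNReal.ofReal (t ^ 2 / 2) := by
    rw [hE, ← lintegral_haar_profile t]; exact lintegral_mono hmin_le
  have hlow : ENNReal.ofReal (t ^ 2 / 2) ≤ μ.prod μ {p | ‖su2Quat p.1 * su2Quat p.2 - su2Quat p.2 * su2Quat p.1‖ ≤ t} +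
      ENNReal.ofReal (t ^ 2 * (t / Real.sqrt (4 - t ^ 2)) / Real.pi) := by
    rw [hE, ← lintegral_haar_profile t]
    calc ∫⁻ a, ENNReal.ofReal (X a) ∂μ ≤ ∫⁻ a, (ENNReal.ofReal (min 1 (X a)) +
          ({a : Matrix.specialUnitaryGroup (Fin 2) ℂ | ‖(su2Quat a).im‖ ^ 2 < t ^ 2 / 4}).indicator (fun a => ENNReal.ofReal (X a)) a) ∂μ :=
          lintegral_mono hX_le
      _ = (∫⁻ a, ENNReal.ofReal (min 1 (X a)) ∂μ) + ∫⁻ a, ({a : Matrix.specialUnitaryGroup (Fin 2) ℂ |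
            ‖(su2Quat a).im‖ ^ 2 < t ^ 2 / 4}).indicator (fun a => ENNReal.ofReal (X a)) a ∂μ := by
          refine lintegral_add_left ?_ _
          exact ENNReal.measurable_ofReal.comp (measurable_const.min ((measurable_const.div
            ((((Quaternion.continuous_im.comp continuous_su2Quat).norm).pow 2 |>.measurable).const_mul 4))))
      _ ≤ _ := by gcongr; exact lintegral_haar_profile_sat_le ht ht2
  have hfin : μ.prod μ {p | ‖su2Quat p.1 * su2Quat p.2 - su2Quat p.2 * su2Quat p.1‖ ≤ t} ≠ ⊤ := measure_ne_top _ _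
  constructor
  · have h := ENNReal.toReal_mono (ENNReal.add_ne_top.2 ⟨hfin, ENNReal.ofReal_ne_top⟩) hlow
    rw [ENNReal.toReal_ofReal (by positivity), ENNReal.toReal_add hfin ENNReal.ofReal_ne_top,
      ENNReal.toReal_ofReal (by positivity)] at h
    rw [measureReal_def]; linarith
  · have h := ENNReal.toReal_mono ENNReal.ofReal_ne_top hup
    rwa [ENNReal.toReal_ofReal (by positivity)] at h

/-- ★★★ **NEARLY COMMUTING PAIR, EXACT CONSTANT `v₂ = 1/2` WITH REMAINDER `t³`**: `|Haar²{‖[q₁,q₂]‖ ≤ t} − t²/2| ≤ t³` for `0 ≤ t ≤ 1`. [folklore] -/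
theorem abs_haar_pair_commBall_sub_le {t : ℝ} (ht : 0 ≤ t) (ht1 : t ≤ 1) :
    |((haarProbability (Matrix.specialUnitaryGroup (Fin 2) ℂ)).prod (haarProbability (Matrix.specialUnitaryGroup (Fin 2) ℂ))).real
        {p | ‖su2Quat p.1 * su2Quat p.2 - su2Quat p.2 * su2Quat p.1‖ ≤ t} - t ^ 2 / 2| ≤ t ^ 3 := by
  obtain ⟨hlo, hhi⟩ := haar_pair_commBall_two_sided ht (by linarith)
  -- `ρ = t/√(4−t²) ≤ t/√3 ≤ t` and `t²ρ/π ≤ t³`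
  have h3 : Real.sqrt 3 ≤ Real.sqrt (4 - t ^ 2) := Real.sqrt_le_sqrt (by nlinarith)
  have hs3 : 1 ≤ Real.sqrt 3 := by
    rw [show (1 : ℝ) = Real.sqrt 1 by simp]; exact Real.sqrt_le_sqrt (by norm_num)
  have hden : 1 ≤ Real.sqrt (4 - t ^ 2) := hs3.trans h3
  have hρ : t / Real.sqrt (4 - t ^ 2) ≤ t := div_le_self ht hden
  have hρ0 : 0 ≤ t / Real.sqrt (4 - t ^ 2) := div_nonneg ht (Real.sqrt_nonneg _)
  have hπ : t ^ 2 * (t / Real.sqrt (4 - t ^ 2)) / Real.pi ≤ t ^ 3 := by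
    rw [div_le_iff₀ Real.pi_pos]
    have hπ3 : (3 : ℝ) < Real.pi := Real.pi_gt_three
    nlinarith [mul_le_mul_of_nonneg_left hρ (sq_nonneg t), sq_nonneg t, pow_nonneg ht 3]
  rw [abs_le]; constructor <;> linarith

end Summit.QuantumFields.YangMills.Theorems.SwapVirialDeficit.ZeroModeExact

end
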